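/-
Origin: expansion seat `planner-pub-hodgecm-pv02-g2-0`, handover 2026-08-18T04:4xZ (`HOME/pub-hodgecm-pv02-g2/lean/Pv02g2/PerL34/QautDictionary.lean`, md5 2558dd61, 265 lines);
landed by the gen-6 packager in gate run 22 as `HodgeCM/PerL34/QautDictionary.lean` (verbatim).
-/
/-
Origin: HOME/pub-hodgecm-pv02-g2/lean/Pv02g2/PerL34/QautDictionary.lean — session planner-pub-hodgecm-pv02-g2-0 (unit
pub-hodgecm-pv02-g2, DAG-NODE PROVER #02 gen 2; LEMMAS v4 §9 seam S5, `N19g_core` half).  Intended final place: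
`HodgeCM/PerL34/QautDictionary.lean`, after the LANDED `HodgeCM/PerL34/QautWedge.lean` (pv02, run 20) and
`HodgeCM/PerL34/OpenInputsN19.lean` (pv08, run 20); imports `HodgeCM.*` only.  KERNEL modulo a named dictionary:
nothing cited as a fact, nothing asserted; every field of the bridge record is labelled below.
-/
import Summits.HodgeConjecture.HodgeCM.PerL34.QautWedge_2
import Summits.HodgeConjecture.HodgeCM.PerL34.OpenInputsN19

/-!
# Seam S5, `N19g_core` half — the (gen ⊆ wedge span) core of Lemma 3.5 is KERNEL modulo the Qaut dictionary

LEMMAS v4 §9 **S5** ("`N19g_core` (dense `P ⊂ 𝒮` with `ϑ_χ(Φ) ∈ span(wedges)` — Fock K-type / U(1)-weight count at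
`ι₁`) ← pv02 `Qaut.{pr_mul_mem_span_wedge, wedge_eq_two_smul_pr, pr_mul_eq_zero_of_weights}` (`QautWedge`, in tree)
+ pv12 `FockKTypes` (in tree) + pv01 `N26_holds` + PRINT BW VIII 2.10/2.14, VI 4.11, VII 4.11, Adams 2007 6.3/6.6 …
BRIDGE missing: `T.SK V c` / `D.ϑ` / `T.Λ` := the lattice model's Schwartz space, torus period and cup pairing (D4)
and the (1,0)-part ↔ Fock dictionary (D5)").  pv11's `SeesawDictionary.lean` (HANDOVER 04:17:49Z) does the
`N19w_genIdentity` half in exactly this shape; this file does the other half.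

PerL v5, proof of Lemma 3.5 `lem:S12`, tex ll. 356–372 (verbatim, the (gen ⊆) direction): "Let `\mathcal P\subset\cS`
be the subspace of functions which are Fock polynomials (times the Gaussian) at the archimedean places; it is dense in
`\cS` … and `\mathrm{pr}_\kappa(\mathcal P)` is dense in `\cS^\kappa`. By continuity of `\vartheta_{T,\chi_{12}}` it
suffices to treat `\Phi\in\mathrm{pr}_\kappa(\mathcal P)`, which are finite sums of `\mathrm{pr}_\kappa(\phi_1\otimes
\phi_2)` with `\phi_j` … Fock polynomials of pure `K_\infty`-types … By \eqref{eq:seesaw}, `\vartheta_{T,\chi_{12}}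
(\mathrm{pr}_\kappa(\phi_1\otimes\phi_2))=\mathrm{pr}_\kappa\big(\theta(\phi_1,\chi'_1)\theta(\phi_2,\chi'_2)\big)`, and
`\theta(\phi_j,\chi'_j)\in\pi_j` has the `K_\infty`-type of `\phi_j`, hence vanishes unless that type occurs in
`J^+\boxtimes\mathbf 1` … its `K_{\iota_1}`-types are `\mathrm{Sym}^{n}(V^+)\otimes(V^-)^{\otimes-n}`, `n\ge1`, each
once … A product of vectors of types `\mathrm{Sym}^{n_1}(V^+)\otimes(V^-)^{-n_1}` and `\mathrm{Sym}^{n_2}(V^+)\otimes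
(V^-)^{-n_2}` has `\U(1)`-weight `-n_1-n_2`, while `\kappa=\wedge^2V^+\otimes(V^-)^{-2}` has weight `-2`; so
`\mathrm{pr}_\kappa` of the product vanishes unless `n_1=n_2=1`, i.e. unless both factors lie in the lowest
`K_\infty`-type `\fp_+=V^+\otimes(V^-)^{-1}`, in which case `\mathrm{pr}_\kappa(f_1f_2)` is the wedge combination of
\S\ref{ss:forms} (the vectors `\theta(\phi_j,\chi'_j)`, `\phi_j` of type `\fp_+`, are annihilated by `\fp_-`, `\fp_+`
being the lowest `K_{\iota_1}`-type of `J^+`, so they are components of holomorphic `1`-forms, which lie in `U_{t^j}`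
by Lemma~\ref{lem:allowed}(a)). Hence every `K`-finite generator of `S_{12}` is a linear combination of wedges
`u_1\wedge u_2` of such forms".

## Factorisation typed here (for a side `(D, k, l)`, `χ ∈ D.X` allowed, `Φ` in the dense set `P`)

  `D.ϑ χ Φ` =(field `decomp`: (eq:seesaw) on pure tensors + `K`-type transport, see labels)=
             `toHG (Σ_i pr(f₁ᵢ · f₂ᵢ))`, each `f_jᵢ` of pure `U(1)`-weight `ξ^{n}`, `n ≥ 1`, and in the span of the
             components of the side's theta one-forms when `n = 1`
          ∈ (KERNEL, this file: `Qaut.pr_mul_eq_zero_of_weights` kills every term with `(n₁,n₂) ≠ (1,1)` because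
             `ξ^{n₁} ξ^{n₂} ≠ ξ² = det 𝔭₊(k₀)` for `ξ` of infinite order; `Qaut.pr_mul_mem_span_wedge` puts every term
             with `n₁ = n₂ = 1` in `span{u ∧ v}` — PerL ll. 367–372 EXACTLY)
             `toHG (span{u ∧ v : u ∈ Forms₁ χ, v ∈ Forms₂ χ})`
          ⊆ (field `wedge_mem`, D5/D2)  `span (T.wedgeSet V c k l)`.

## Labels of the bridge fields (G-R2-14 vocabulary; nothing here is a cited fact)

* SHELL / SETUP (D5, the archimedean algebra shell of the landed `QautWedge`): `K` = `K_{ι₁} ≅ U(2) × U(1)` (or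
  `K_∞`) with its Haar probability measure `μ`; `C` = a commutative Banach algebra of bounded right-uniformly
  continuous functions on `G_U(L₀)\G_U(𝔸)` containing the `K`-finite theta functions, `σ` = right translation by
  `K` (algebra automorphisms, strongly continuous: `σ_cont`); `ρ = 𝔭₊ = V⁺ ⊗ (V⁻)⁻¹` in a weight basis (`ρ_cont`,
  `ρ_det`; `ρ_diag`/`ρ_antidiag`: a torus element with distinct weights and a Weyl element — elementary for
  `U(2)` on `V⁺`); `k₀ = (1₂, ζ) ∈ U(2) × U(1)` with `ζ ∈ U(1)` of infinite order, acting on `𝔭₊` by the scalar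
  `ξ = ζ⁻¹` (`ρ_k₀`, `ξ_ne_zero`, `ξ_pow_ne_one`) — this is the "`U(1)`-weight" of l. 368–370: `k₀` acts on the
  `K_{ι₁}`-type `Symⁿ(V⁺) ⊗ (V⁻)^{-n}` by `ξⁿ` and on `κ = ∧²V⁺ ⊗ (V⁻)^{-2}` by `ξ² = det ρ(k₀)`.
* DEFINITIONAL (D2/D5): `Forms₁ χ` / `Forms₂ χ` = the holomorphic theta one-forms `u` of type `Ψ_k` / `Ψ_l`
  attached to vectors of `π_j[𝔭₊]`, `π_j = Θ^{W_j}_{μ_j}(χ'_j)`, `χ = χ'_1 ⊠ χ'_2` (ll. 350–352), as the linear maps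
  `x ↦` (the component `⟨u, x⟩` as a function on the group) — PerL §3.1 ll. 246–248 "a holomorphic 1-form … is a
  pair `(u¹,u²)` of `K_∞`-finite scalar functions in the lowest `K_{ι₁}`-type `𝔭₊`", i.e. `Qaut.IsForm ρ σ u`
  (`isForm₁/₂`); `toHG : C →ₗ[ℂ] L²([G_U])` = the `L²` class (D5; `[G_U]` has finite volume).
* DICTIONARY (the seam itself, INTERNAL-DEFINITIONAL + one PRINT sentence — LEMMAS §3 D2/D4/D5): `wedge_mem` = for
  `χ` allowed and such `u, v`: (i) `u, v` descend to a common torsion-free level `Γ` with classes in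
  `T.Theta V c k Γ`, `T.Theta V c l Γ` (D2: definition of the model's `Theta`; "which lie in `U_{t^j}` by Lemma
  3.3(a)" = node N12, KERNEL pv04, + Prop 2.3 = node N05), (ii) `T.Λ Γ [u] [v] = T.emb Γ ([u] ∪ [v]) = toHG (u ∧ v)`
  with `u ∧ v = u¹v² − u²v¹` (Matsushima dictionary (Qaut), ll. 248–257; D5); `P`, `dense` = `P := pr_κ(𝒫)` is
  dense in `𝒮^κ = T.SK V c` (D4: definition of the model's Schwartz space; PRINT: density of `K`-finite = Hermite
  vectors in the Schwartz space, l. 342 "the `K`-finite (Fock) vectors used so far are dense"); `decomp` = for `χ`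
  allowed and `Φ ∈ P`: `ϑ_{T,χ}(Φ) = Σ_i pr_κ(θ(φ₁ᵢ,χ'_1) θ(φ₂ᵢ,χ'_2))` ((eq:seesaw) on pure tensors = node N17 —
  KERNEL over the lattice shell, pv11 `Seesaw.eq_seesaw` / `SeesawWedge.genIdentity_core`, here through the D4
  definition of `D.ϑ` — plus "`pr_κ` of `𝒮` ↦ `pr` of functions", D5), where each `f_jᵢ = θ(φ_jᵢ, χ'_j)` "has the
  `K_∞`-type of `φ_jᵢ`" (equivariance of the theta lift, SETUP) and that type, if `f_jᵢ ≠ 0`, "occurs in `J⁺ ⊠ 𝟙`"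
  (allowedness, Def 3.2 — `D.allowed χ`, DEFINITIONAL) whose `K_{ι₁}`-types are `Symⁿ(V⁺) ⊗ (V⁻)^{-n}`, `n ≥ 1`
  (PRINT [Y1neg] Lemma 3.1 ← Kashiwara–Vergne 1978 III.6–7 / Adams 2007 Prop. 6.3/6.6; Fock-polynomial side KERNEL:
  pv12 `FockKTypes.hwv_weights`, `jplus_lowest`, `kappaVector_colWt`), so `σ k₀ f_jᵢ = ξⁿ • f_jᵢ` with `n ≥ 1`; and
  for `n = 1`: "`𝔭₊` being the lowest `K_{ι₁}`-type of `J⁺`, [they] are annihilated by `𝔭₋`, so they are components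
  of holomorphic 1-forms" (l. 370–371; PRINT-DERIVED as in node N33b: BW VII 2.5/2.7 + II 4.2, pv14
  `P43Forms.HolomorphicOfPminus`) — `f_jᵢ ∈ span{u x : u ∈ Forms_j χ}`.
  These fields are each WEAKER than `N19g_core` (none mentions `T.wedgeSet`; `wedge_mem` does not mention `D.ϑ`);
  the kernel `U(1)`-weight count + wedge combination (`QautWedge`) is what joins them.

## What is proved here (kernel-checked)

* `QautBridge.pr_mul_mem` — one term: `pr(f₁ f₂) ∈ span{u ∧ v}` (the dichotomy of ll. 367–372);
* `N19g_core_of_bridge : QautBridge T V c D k l → N19g_core T V c D k l`;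
* `N19_genIn_of_bridge` (with pv08's `N19g_of`: the density/continuity passage), `N19_of_bridge` (Lemma 3.5 (i) for
  the side from the seesaw-generator identity (pv11's half), allowedness (N31) and a Qaut bridge);
* `open_thetaReal34_of_bridges` : a bridge at every good context for the (34) side ⇒ `T.Open_thetaReal34`
  (= `N19g_genInWedgeSpan T`, the `h19g` of `perL_of_nodes`) — pv08's `open_thetaReal34_of_core` with its hypothesis
  DISCHARGED modulo the dictionary.

Unit `pub-hodgecm-pv02-g2`, 2026-08-18.  Fully kernel-checked; no new axioms.
-/

set_option autoImplicit false

noncomputable section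

open MeasureTheory Matrix
open HodgeCM.Prior.Perl34File
open HodgeCM.PerL34.Qaut

namespace HodgeCM
namespace PerL34
namespace QautDictionary

variable {U : Universe} (T : U.ThetaModel)
variable {L : CMField} {ι₁ : L →+* ℂ} (V : HermSpace3 L ι₁) (c : SeesawCtx L)
variable (D : Perl34.TorusData (T.core V c)) (k l : Fin 4)

/-- **The S5 bridge record, `N19g` half** for the side `(k,l)` with torus data `D`: the archimedean algebra shell
of `QautWedge`, the central `U(1)`-element, and the D2/D4/D5 dictionary to the model (see the module docstring for
the label of every field). -/
structure QautBridge where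
  /-- SHELL (D5): `K_{ι₁} ≅ U(2) × U(1)` (or `K_∞`) -/
  K : Type
  [instK₁ : Group K]
  [instK₂ : TopologicalSpace K]
  [instK₃ : IsTopologicalGroup K]
  [instK₄ : MeasurableSpace K]
  [instK₅ : BorelSpace K]
  [instK₆ : CompactSpace K]
  /-- its Haar probability measure -/
  μ : Measure K
  [instμ₁ : IsProbabilityMeasure μ]
  [instμ₂ : μ.IsMulLeftInvariant]
  [instμ₃ : μ.IsMulRightInvariant]
  /-- SHELL (D5): a commutative Banach algebra of bounded right-uniformly continuous functions on `G_U(L₀)\G_U(𝔸)` -/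
  C : Type
  [instC₁ : NormedCommRing C]
  [instC₂ : NormedAlgebra ℂ C]
  [instC₃ : CompleteSpace C]
  /-- right translation by `K` (algebra automorphisms), strongly continuous -/
  σ : K →* (C →ₐ[ℂ] C)
  σ_cont : ∀ f : C, Continuous fun x => σ x f
  /-- `ρ = 𝔭₊ = V⁺ ⊗ (V⁻)⁻¹` in a weight basis -/
  ρ : K →* Matrix (Fin 2) (Fin 2) ℂ
  ρ_cont : Continuous fun x => ρ x
  ρ_det : ∀ x, IsUnit (ρ x).det
  /-- a torus element with distinct weights on `𝔭₊`, and a Weyl element -/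
  ρ_diag : ∃ x s t, s ≠ t ∧ ρ x = !![s, 0; 0, t]
  ρ_antidiag : ∃ x a b, ρ x = !![0, a; b, 0]
  /-- the central `U(1)`: `k₀ = (1₂, ζ)`, `ζ` of infinite order, acting on `𝔭₊` by the scalar `ξ = ζ⁻¹` -/
  k₀ : K
  ξ : ℂ
  ξ_ne_zero : ξ ≠ 0
  ξ_pow_ne_one : ∀ m : ℕ, 1 ≤ m → ξ ^ m ≠ 1
  ρ_k₀ : ρ k₀ = ξ • (1 : Matrix (Fin 2) (Fin 2) ℂ)
  /-- DICTIONARY (D5): the `L²` class of a function of the shell -/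
  toHG : C →ₗ[ℂ] T.HG L ι₁ V
  /-- DEFINITIONAL (D2/D5): holomorphic theta one-forms of type `Ψ_k` (resp. `Ψ_l`) attached to vectors of
  `π_1[𝔭₊]` (resp. `π_2[𝔭₊]`) for the character `χ = χ'_1 ⊠ χ'_2`, as component maps -/
  Forms₁ : D.X → Set ((Fin 2 → ℂ) →ₗ[ℂ] C)
  Forms₂ : D.X → Set ((Fin 2 → ℂ) →ₗ[ℂ] C)
  isForm₁ : ∀ χ, ∀ u ∈ Forms₁ χ, IsForm ρ σ u
  isForm₂ : ∀ χ, ∀ v ∈ Forms₂ χ, IsForm ρ σ v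
  /-- DICTIONARY (D2 + Matsushima (Qaut) D5 + L3.3(a)): the wedge of such forms is a model wedge-function -/
  wedge_mem : ∀ χ, D.allowed χ → ∀ u ∈ Forms₁ χ, ∀ v ∈ Forms₂ χ, toHG (wedge u v) ∈ T.wedgeSet V c k l
  /-- D4 + PRINT (density of `K`-finite vectors): the dense subspace `pr_κ(𝒫) ⊆ 𝒮^κ` -/
  P : Set (T.SK V c)
  dense : Dense P
  /-- DICTIONARY ((eq:seesaw) on pure tensors, N17; `K`-type transport; `K`-type list of `J⁺`, PRINT; `𝔭₊`-vectors
  are components of holomorphic one-forms, PRINT-DERIVED): the finite-sum decomposition of a generator -/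
  decomp : ∀ χ, D.allowed χ → ∀ Φ ∈ P, ∃ (n : ℕ) (f₁ f₂ : Fin n → C) (w₁ w₂ : Fin n → ℕ),
    (∀ i, 1 ≤ w₁ i ∧ σ k₀ (f₁ i) = ξ ^ (w₁ i) • f₁ i ∧
      (w₁ i = 1 → f₁ i ∈ Submodule.span ℂ {f | ∃ u ∈ Forms₁ χ, ∃ x, f = u x})) ∧
    (∀ i, 1 ≤ w₂ i ∧ σ k₀ (f₂ i) = ξ ^ (w₂ i) • f₂ i ∧
      (w₂ i = 1 → f₂ i ∈ Submodule.span ℂ {f | ∃ v ∈ Forms₂ χ, ∃ y, f = v y})) ∧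
    D.ϑ χ Φ = toHG (∑ i, pr μ ρ σ (f₁ i * f₂ i))

attribute [instance] QautBridge.instK₁ QautBridge.instK₂ QautBridge.instK₃ QautBridge.instK₄ QautBridge.instK₅
  QautBridge.instK₆ QautBridge.instμ₁ QautBridge.instμ₂ QautBridge.instμ₃ QautBridge.instC₁ QautBridge.instC₂
  QautBridge.instC₃

namespace QautBridge

variable {T V c D k l}
variable (B : QautBridge T V c D k l)

/-- `det 𝔭₊(k₀) = ξ²`. -/
theorem det_ρ_k₀ : (B.ρ B.k₀).det = B.ξ ^ 2 := by
  rw [B.ρ_k₀, det_smul, det_one, mul_one, Fintype.card_fin]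

/-- **The `U(1)`-weight count, arithmetic half** (l. 368–370): for `n₁, n₂ ≥ 1` not both `1`,
`ξ^{n₁} ξ^{n₂} ≠ ξ² = det 𝔭₊(k₀)` since `ξ` has infinite order. -/
theorem weights_ne_det {n₁ n₂ : ℕ} (h₁ : 1 ≤ n₁) (h₂ : 1 ≤ n₂) (h : ¬(n₁ = 1 ∧ n₂ = 1)) :
    B.ξ ^ n₁ * B.ξ ^ n₂ ≠ (B.ρ B.k₀).det := by
  rw [B.det_ρ_k₀, ← pow_add]
  have h3 : 2 + 1 ≤ n₁ + n₂ := by omega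
  obtain ⟨m, hm⟩ := Nat.exists_eq_add_of_le h3
  intro heq
  have h2ne : B.ξ ^ 2 ≠ 0 := pow_ne_zero _ B.ξ_ne_zero
  have hm' : n₁ + n₂ = 2 + (m + 1) := by omega
  rw [hm', pow_add] at heq
  have hone : B.ξ ^ (m + 1) = 1 := by
    have := mul_left_cancel₀ h2ne (heq.trans (mul_one (B.ξ ^ 2)).symm)
    exact this
  exact B.ξ_pow_ne_one (m + 1) (by omega) hone

/-- **One term of the decomposition lies in the span of the wedges** — PerL ll. 367–372: if `(n₁,n₂) ≠ (1,1)` the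
`κ`-projection of `f₁ f₂` VANISHES (`Qaut.pr_mul_eq_zero_of_weights`); if `n₁ = n₂ = 1` both factors are (sums of)
components of holomorphic theta one-forms and `pr(f₁ f₂)` is the wedge combination of §3.1
(`Qaut.pr_mul_mem_span_wedge`). -/
theorem pr_mul_mem (χ : D.X) {f₁ f₂ : B.C} {n₁ n₂ : ℕ} (h₁ : 1 ≤ n₁) (h₂ : 1 ≤ n₂)
    (e₁ : B.σ B.k₀ f₁ = B.ξ ^ n₁ • f₁) (e₂ : B.σ B.k₀ f₂ = B.ξ ^ n₂ • f₂)
    (s₁ : n₁ = 1 → f₁ ∈ Submodule.span ℂ {f | ∃ u ∈ B.Forms₁ χ, ∃ x, f = u x})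
    (s₂ : n₂ = 1 → f₂ ∈ Submodule.span ℂ {f | ∃ v ∈ B.Forms₂ χ, ∃ y, f = v y}) :
    pr B.μ B.ρ B.σ (f₁ * f₂) ∈ Submodule.span ℂ {g | ∃ u ∈ B.Forms₁ χ, ∃ v ∈ B.Forms₂ χ, g = wedge u v} := by
  by_cases h : n₁ = 1 ∧ n₂ = 1
  · exact pr_mul_mem_span_wedge B.ρ_cont B.ρ_det B.σ_cont B.ρ_diag B.ρ_antidiag (B.Forms₁ χ) (B.Forms₂ χ)
      (B.isForm₁ χ) (B.isForm₂ χ) (s₁ h.1) (s₂ h.2)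
  · rw [pr_mul_eq_zero_of_weights B.ρ_det B.k₀ e₁ e₂ (B.weights_ne_det h₁ h₂ h)]
    exact Submodule.zero_mem _

/-- The dictionary field `wedge_mem` on spans: `toHG` maps the span of the wedges into the span of the model's
wedge-functions. -/
theorem map_span_wedge_le (χ : D.X) (hχ : D.allowed χ) :
    (Submodule.span ℂ {g | ∃ u ∈ B.Forms₁ χ, ∃ v ∈ B.Forms₂ χ, g = wedge u v}).map B.toHG ≤
      Submodule.span ℂ (T.wedgeSet V c k l) := by
  rw [Submodule.map_span, Submodule.span_le]
  rintro _ ⟨g, ⟨u, hu, v, hv, rfl⟩, rfl⟩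
  exact Submodule.subset_span (B.wedge_mem χ hχ u hu v hv)

end QautBridge

variable {T V c D k l}

/-- **Seam S5, `N19g` half (KERNEL modulo the dictionary):** the model-level finite-sum core on a dense subspace
`S12Wedges.N19g_core` follows from a bridge record, the join being the landed kernel `U(1)`-weight count and wedge
combination of `QautWedge` (PerL ll. 367–372). -/
theorem N19g_core_of_bridge (B : QautBridge T V c D k l) : N19g_core T V c D k l := by
  refine ⟨B.P, B.dense, fun χ hχ Φ hΦ => ?_⟩
  obtain ⟨n, f₁, f₂, w₁, w₂, hw₁, hw₂, hϑ⟩ := B.decomp χ hχ Φ hΦ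
  rw [hϑ]
  refine B.map_span_wedge_le χ hχ (Submodule.mem_map.mpr ⟨_, ?_, rfl⟩)
  exact Submodule.sum_mem _ fun i _ =>
    B.pr_mul_mem χ (hw₁ i).1 (hw₂ i).1 (hw₁ i).2.1 (hw₂ i).2.1 (hw₁ i).2.2 (hw₂ i).2.2

/-- The (gen ⊆ closed wedge span) inclusion of Lemma 3.5 for the side, from a bridge (pv08's `N19g_of`: the
density/continuity passage l. 358–359 is KERNEL). -/
theorem N19_genIn_of_bridge (B : QautBridge T V c D k l) : N19_genIn T V c D k l :=
  N19g_of T V c D k l (N19g_core_of_bridge B)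

/-- **Lemma 3.5 (i) for the side** from the seesaw-generator identity (node N17 residue; pv11's `SeesawBridge`
discharges it modulo its dictionary), allowedness (node N31) and a Qaut bridge. -/
theorem N19_of_bridge (hgen : N19w_genIdentity T V c D k l) (hch : N19_charsIn T V c D)
    (B : QautBridge T V c D k l) : N19_statement T V c D k l :=
  N19_of_cores T V c D k l hgen hch (N19g_core_of_bridge B)

variable (T) in
/-- **pv08's adapter with its hypothesis DISCHARGED:** a Qaut bridge at every good context for the (34) side gives
the realisation input `Open_thetaReal34` (= `N19g_genInWedgeSpan T`, the `h19g` of `perL_of_nodes`). -/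
theorem open_thetaReal34_of_bridges
    (hB : ∀ {L : CMField} {ι₁ : L →+* ℂ} (V : HermSpace3 L ι₁) (c : SeesawCtx L), T.GoodCtx ι₁ c →
      Nonempty (QautBridge T V c (T.t34 V c) 2 3)) :
    T.Open_thetaReal34 :=
  open_thetaReal34_of_core T fun V c hc => (hB V c hc).elim fun B => N19g_core_of_bridge B

end QautDictionary
end PerL34
end HodgeCM

end
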